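/-
VALUE = THEOREM (the all-`p` character-sum toolkit for the unified reflection-class certificate),
NOT summit progress (cell b2b-lgcu-borel, gen 24); the crux item stmt-MatrixMultiplication-14079
is untouched.
-/
import Mathlib
import Literature.NumberTheory.QuadraticFields.BakerLimitFormulaCharSums
import Literature.NumberTheory.QuadraticFields.ChowlaCentralFactorialProofs
import Literature.NumberTheory.EllipticCurves.BinaryQuarticDiscriminantFpCountProofs
import Summits.MatrixMultiplication.MatrixMultiplication.Theorems.SubgroupIdentityDesigns.Negative.ReflectionClassCertificate

/-!
# Character sums for the all-`p` reflection-class certificate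

VALUE = THEOREM (generic in the odd prime `p`), NOT summit progress; the crux item
stmt-MatrixMultiplication-14079 is untouched and remains open.

The orbit sums of the unified certificate `ReflectionClassCertificate.cert` (ORACLE-g23 §G23-4)
vanish for EVERY prime `p ≥ 5`; the proof (ORACLE-g24 §G24-1, checked assertion by assertion for
`p ≤ 19`) evaluates them by three elementary quadratic-character sums, which this file provides
once and for all (`χ = quadraticChar (ZMod p)`; `chi_eq` identifies the certificate's `chi`):

* `sum_quadratic` — `Σ_u χ(a u² + b u + d) = (p − 1)χ(a)` if `b² = 4ad`, `= −χ(a)` otherwise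
  (`a ≠ 0`; completing the square onto `sum_quadraticChar_sq_sub` of the Literature);
* `sum_bqf_eq_zero` — `Σ_{s,t} χ(α s² + β s t + γ t²) = 0` for a non-degenerate binary form;
* `sum_bqf_rank_one` — `= p(p − 1)χ(v)` for a degenerate non-zero form taking the value `v ≠ 0`.

The unipotent orbit sums (case (U)) use `sum_quadratic` three times; the split/non-split torus
orbit sums (case (S2)) use the two binary-form sums on the plane `x^⊥`.
HONEST SCOPE.  Toolkit only; by itself it excludes nothing.
-/

set_option linter.dupNamespace false

open scoped BigOperators

namespace Summit.MatrixMultiplication.MatrixMultiplication.Theorems.SubgroupIdentityDesigns.Negative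
namespace ReflectionClassCharSums

open Literature.NumberTheory.QuadraticFields.BakerLimitFormula (sum_quadraticChar_sq_sub)
open Literature.NumberTheory.QuadraticFields.ChowlaProof (ringChar_ne_two)
open Literature.NumberTheory.EllipticCurves.BinaryQuartic (two_ne_zero_zmod)

variable {p : ℕ} [hp : Fact p.Prime]

/-- The certificate's `chi` is Mathlib's quadratic character. -/
theorem chi_eq (a : ZMod p) : ReflectionClassCertificate.chi a = quadraticChar (ZMod p) a := by
  rw [quadraticChar_apply, quadraticCharFun, ReflectionClassCertificate.chi]

/-- `Σ_t (if t = 0 then A else B) = A + (p − 1) B` over `𝔽_p`. -/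
theorem sum_ite_zero (A B : ℤ) :
    ∑ t : ZMod p, (if t = 0 then A else B) = A + ((p : ℤ) - 1) * B := by
  rw [Finset.sum_ite, Finset.sum_const, Finset.sum_const, Finset.filter_eq',
    if_pos (Finset.mem_univ _), Finset.card_singleton, Finset.filter_ne',
    Finset.card_erase_of_mem (Finset.mem_univ _), Finset.card_univ, ZMod.card]
  have h1 : 1 ≤ p := hp.out.one_lt.le
  simp only [one_smul, nsmul_eq_mul, Nat.cast_sub h1, Nat.cast_one]

/-- `Σ_u χ(u²) = p − 1`. -/
theorem sum_sq : ∑ u : ZMod p, quadraticChar (ZMod p) (u ^ 2) = (p : ℤ) - 1 := by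
  have h : ∀ u : ZMod p, quadraticChar (ZMod p) (u ^ 2) = if u = 0 then (0 : ℤ) else 1 := by
    intro u
    split_ifs with hu
    · rw [hu, zero_pow two_ne_zero, MulChar.map_zero]
    · exact quadraticChar_sq_one' hu
  simp_rw [h, sum_ite_zero]
  ring

/-- **Quadratic polynomial sums.**  For `a ≠ 0`:
`Σ_u χ(a u² + b u + d) = (p − 1) χ(a)` if `b² − 4ad = 0` and `= −χ(a)` otherwise
(`4a(au² + bu + d) = (2au + b)² − (b² − 4ad)`). -/
theorem sum_quadratic (hp2 : p ≠ 2) {a : ZMod p} (ha : a ≠ 0) (b d : ZMod p) :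
    ∑ u : ZMod p, quadraticChar (ZMod p) (a * u ^ 2 + b * u + d) =
      if b ^ 2 - 4 * a * d = 0 then ((p : ℤ) - 1) * quadraticChar (ZMod p) a
      else -quadraticChar (ZMod p) a := by
  set D := b ^ 2 - 4 * a * d with hDdef
  have h2a : 2 * a ≠ 0 := mul_ne_zero (two_ne_zero_zmod hp2) ha
  have key : ∀ u : ZMod p, quadraticChar (ZMod p) (a * u ^ 2 + b * u + d) =
      quadraticChar (ZMod p) a * quadraticChar (ZMod p) ((2 * a * u + b) ^ 2 - D) := by
    intro u
    have h1 : (2 * a * u + b) ^ 2 - D = (4 * a) * (a * u ^ 2 + b * u + d) := by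
      rw [hDdef]; ring
    rw [h1, map_mul, ← mul_assoc, ← map_mul, show a * (4 * a) = (2 * a) ^ 2 by ring,
      quadraticChar_sq_one' h2a, one_mul]
  simp_rw [key]
  rw [← Finset.mul_sum]
  have hbij : ∑ u : ZMod p, quadraticChar (ZMod p) ((2 * a * u + b) ^ 2 - D) =
      ∑ v : ZMod p, quadraticChar (ZMod p) (v ^ 2 - D) := by
    refine Fintype.sum_equiv (((Units.mk0 (2 * a) h2a).mulLeft).trans (Equiv.addRight b)) _ _ ?_
    intro u
    simp only [Equiv.trans_apply, Units.mulLeft_apply, Units.val_mk0, Equiv.coe_addRight]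
  rw [hbij]
  split_ifs with hD
  · have hD' : D = 0 := hD
    simp only [hD', sub_zero, sum_sq]
    ring
  · rw [sum_quadraticChar_sq_sub (ringChar_ne_two hp2) hD]
    ring

/-- **Binary quadratic forms, non-degenerate case:** `Σ_{s,t} χ(α s² + β s t + γ t²) = 0` when
`β² − 4αγ ≠ 0`. -/
theorem sum_bqf_eq_zero (hp2 : p ≠ 2) {α β γ : ZMod p} (hD : β ^ 2 - 4 * α * γ ≠ 0) :
    ∑ s : ZMod p, ∑ t : ZMod p, quadraticChar (ZMod p) (α * s ^ 2 + β * s * t + γ * t ^ 2) = 0 := by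
  by_cases hα : α = 0
  · subst hα
    have hβ : β ≠ 0 := by
      intro h; apply hD; rw [h]; ring
    by_cases hγ : γ = 0
    · subst hγ
      have h1 : ∀ s t : ZMod p, quadraticChar (ZMod p) (0 * s ^ 2 + β * s * t + 0 * t ^ 2) =
          quadraticChar (ZMod p) β * quadraticChar (ZMod p) s * quadraticChar (ZMod p) t := by
        intro s t
        rw [zero_mul, zero_mul, zero_add, add_zero, map_mul, map_mul]
      simp_rw [h1, ← Finset.mul_sum, quadraticChar_sum_zero (ringChar_ne_two hp2), mul_zero,
        Finset.sum_const_zero]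
    · -- inner sum over `t` is quadratic in `t` with leading coefficient `γ`
      have h1 : ∀ s : ZMod p,
          ∑ t : ZMod p, quadraticChar (ZMod p) (0 * s ^ 2 + β * s * t + γ * t ^ 2) =
            if s = 0 then ((p : ℤ) - 1) * quadraticChar (ZMod p) γ
            else -quadraticChar (ZMod p) γ := by
        intro s
        have h2 : ∀ t : ZMod p, 0 * s ^ 2 + β * s * t + γ * t ^ 2 = γ * t ^ 2 + (β * s) * t + 0 := by
          intro t; ring
        simp_rw [h2, sum_quadratic hp2 hγ]
        have h3 : (β * s) ^ 2 - 4 * γ * 0 = 0 ↔ s = 0 := by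
          rw [mul_zero, sub_zero, pow_eq_zero_iff two_ne_zero, mul_eq_zero]
          exact ⟨fun h => h.resolve_left hβ, fun h => Or.inr h⟩
        simp only [h3]
      simp_rw [h1, sum_ite_zero]
      ring
  · rw [Finset.sum_comm]
    have h1 : ∀ t : ZMod p,
        ∑ s : ZMod p, quadraticChar (ZMod p) (α * s ^ 2 + β * s * t + γ * t ^ 2) =
          if t = 0 then ((p : ℤ) - 1) * quadraticChar (ZMod p) α
          else -quadraticChar (ZMod p) α := by
      intro t
      have h2 : ∀ s : ZMod p,
          α * s ^ 2 + β * s * t + γ * t ^ 2 = α * s ^ 2 + (β * t) * s + γ * t ^ 2 := by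
        intro s; ring
      simp_rw [h2, sum_quadratic hp2 hα]
      have h3 : (β * t) ^ 2 - 4 * α * (γ * t ^ 2) = 0 ↔ t = 0 := by
        rw [show (β * t) ^ 2 - 4 * α * (γ * t ^ 2) = (β ^ 2 - 4 * α * γ) * t ^ 2 by ring,
          mul_eq_zero, pow_eq_zero_iff two_ne_zero]
        exact ⟨fun h => h.resolve_left hD, fun h => Or.inr h⟩
      simp only [h3]
    simp_rw [h1, sum_ite_zero]
    ring

/-- **Binary quadratic forms, rank-one case:** if `β² − 4αγ = 0` and the form takes a non-zero
value `v = α s₀² + β s₀ t₀ + γ t₀²`, then `Σ_{s,t} χ(α s² + β s t + γ t²) = p (p − 1) χ(v)`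
(the form is `κ ℓ²` for a non-zero linear form `ℓ`, and `χ(κ) = χ(v)`). -/
theorem sum_bqf_rank_one (hp2 : p ≠ 2) {α β γ : ZMod p} (hD : β ^ 2 - 4 * α * γ = 0)
    {s₀ t₀ : ZMod p} (hv : α * s₀ ^ 2 + β * s₀ * t₀ + γ * t₀ ^ 2 ≠ 0) :
    ∑ s : ZMod p, ∑ t : ZMod p, quadraticChar (ZMod p) (α * s ^ 2 + β * s * t + γ * t ^ 2) =
      (p : ℤ) * ((p : ℤ) - 1) *
        quadraticChar (ZMod p) (α * s₀ ^ 2 + β * s₀ * t₀ + γ * t₀ ^ 2) := by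
  by_cases hα : α = 0
  · subst hα
    have hβ : β = 0 := by
      have : β ^ 2 = 0 := by simpa using hD
      exact pow_eq_zero_iff two_ne_zero |>.mp this
    subst hβ
    simp only [zero_mul, zero_add] at hv ⊢
    have ht₀ : t₀ ≠ 0 := fun h => hv (by rw [h, zero_pow two_ne_zero, mul_zero])
    have h1 : ∀ t : ZMod p, quadraticChar (ZMod p) (γ * t ^ 2) =
        if t = 0 then (0 : ℤ) else quadraticChar (ZMod p) γ := by
      intro t
      split_ifs with ht
      · rw [ht, zero_pow two_ne_zero, mul_zero, MulChar.map_zero]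
      · rw [map_mul, quadraticChar_sq_one' ht, mul_one]
    simp_rw [h1, sum_ite_zero, Finset.sum_const, Finset.card_univ, ZMod.card, if_neg ht₀]
    simp only [nsmul_eq_mul, zero_add]
    ring
  · have h2a : 2 * α ≠ 0 := mul_ne_zero (two_ne_zero_zmod hp2) hα
    have key : ∀ s t : ZMod p, quadraticChar (ZMod p) (α * s ^ 2 + β * s * t + γ * t ^ 2) =
        quadraticChar (ZMod p) α * quadraticChar (ZMod p) ((2 * α * s + β * t) ^ 2) := by
      intro s t
      have h1 : (2 * α * s + β * t) ^ 2 = (4 * α) * (α * s ^ 2 + β * s * t + γ * t ^ 2) := by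
        have : β ^ 2 = 4 * α * γ := sub_eq_zero.mp hD
        linear_combination t ^ 2 * this
      rw [h1, map_mul, ← mul_assoc, ← map_mul, show α * (4 * α) = (2 * α) ^ 2 by ring,
        quadraticChar_sq_one' h2a, one_mul]
    have hsq : ∀ t : ZMod p,
        ∑ s : ZMod p, quadraticChar (ZMod p) ((2 * α * s + β * t) ^ 2) = (p : ℤ) - 1 := by
      intro t
      rw [← sum_sq (p := p)]
      refine Fintype.sum_equiv
        (((Units.mk0 (2 * α) h2a).mulLeft).trans (Equiv.addRight (β * t))) _ _ ?_
      intro s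
      simp only [Equiv.trans_apply, Units.mulLeft_apply, Units.val_mk0, Equiv.coe_addRight]
    have hv' : quadraticChar (ZMod p) (α * s₀ ^ 2 + β * s₀ * t₀ + γ * t₀ ^ 2) =
        quadraticChar (ZMod p) α := by
      have hne : (2 * α * s₀ + β * t₀) ≠ 0 := by
        intro h
        apply hv
        have := key s₀ t₀
        rw [h, zero_pow two_ne_zero, MulChar.map_zero, mul_zero, quadraticChar_eq_zero_iff] at this
        exact this
      rw [key, quadraticChar_sq_one' hne, mul_one]
    rw [hv']
    simp_rw [key, ← Finset.mul_sum]
    rw [Finset.sum_comm]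
    simp_rw [hsq, Finset.sum_const, Finset.card_univ, ZMod.card, nsmul_eq_mul]
    ring

end ReflectionClassCharSums
end Summit.MatrixMultiplication.MatrixMultiplication.Theorems.SubgroupIdentityDesigns.Negative
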